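/-
Δ2 BRIDGE ∕ ¬hJ lane, HEAD-B risk item R1, brick (R1-b): **Betti cohomology is additive over a finite (indeed any small) coproduct
cofan of complex schemes** — for a colimit cofan `inj_c : Y_c ⟶ X` in `SchemeOver ℂ`, the map `x ↦ ((inj_c)^* x)_c :
Hⁿ(X(ℂ); ℚ) → Π_c Hⁿ(Y_c(ℂ); ℚ)` is bijective (Hatcher §3.1 p. 202, `Hⁿ(∐ X_α) ≅ ∏ Hⁿ(X_α)`; SGA1 XII Prop. 3.1 (xi): the legs are
open immersions, hence open embeddings on complex points, and their images partition `X(ℂ)`).  With it [Liu2021] Lem. 2.4 (1) AS PRINTED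
(`(α_K)_x^* : H¹(Alb_{X_K} ⊗ ℂ; ℚ) ≅ H¹(X_K ⊗ ℂ; ℚ)`) and its reading «through the components» are equivalent.
Seat prover-pub-hodgecm2-d2bridge-prove-5-g8-0; DESK file (HEAD-B is background per the LEAD); theorems only, no named fact, no `sorry` intended.
HC_CM is NOT proved; nothing here asserts hJ, hJ₀ or their negations.
-/
import Literature.AlgebraicGeometry.HodgeTheory.BettiUniverseAxioms
import Literature.AlgebraicGeometry.Morphisms.ClopenPieceOfCoproduct
import Literature.NumberTheory.Transcendental.Analytification
import Literature.AlgebraicTopology.SingularHomology.CohomologyDisjointOpenCover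
import HarnessLib

/-!
# Betti cohomology is additive over a colimit cofan of complex schemes

For a colimit cofan `inj c : Y c ⟶ X` in `SchemeOver ℂ` (any small index type), `x ↦ ((inj c)^* x)_c : Hⁿ(X(ℂ); ℚ) → Π_c Hⁿ(Y_c(ℂ); ℚ)`
is bijective (`BettiCofan.bijective_pi_pull`): the legs are open immersions whose complex points partition `X(ℂ)`
(`isClopenPartition_range_map`), and singular cohomology of a disjoint open cover is the product.  Mathlib-level; no named fact.
Author d2bridge-prove-5 (desk `BettiCofanAdditivity.lean` cca39e849619658e, body byte-identical below); consumer: the ¬hJ HEAD-B R1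
derivation `Summits/…/D2Bridge/NotHJAlbStarBijectiveOfLemma24.lean`.
[Hatcher2002] A. Hatcher, *Algebraic Topology*, §3.1 (p. 202: `Hⁿ(∐ X_α) ≅ ∏ Hⁿ(X_α)`); [SGA1] Exp. XII Prop. 3.1 (xi).
-/

set_option autoImplicit false

noncomputable section

open CategoryTheory CategoryTheory.Limits Topology Function AlgebraicGeometry
open Literature.AlgebraicTopology.SingularHomology

namespace Literature.AlgebraicGeometry.Motives.BettiCofan

universe v

variable {X : SchemeOver ℂ} {κ : Type v} [Small.{0} κ] {Y : κ → SchemeOver ℂ} {inj : ∀ c, Y c ⟶ X}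

/-- **The complex points of the legs of a colimit cofan partition `X(ℂ)` into open pieces** (legs are open immersions —
`Morphisms.isOpenImmersion_of_isColimit_cofan` — hence open embeddings on complex points, SGA1 XII Prop. 3.1 (xi)
`AlgPoints.isOpenEmbedding_map_holds`; their scheme-theoretic images are disjoint and cover, and `Q ∈ im (inj_c)(ℂ) ↔ Q.pt ∈ im inj_c`,
`AlgPoints.range_map_of_isOpenImmersion_holds`). [cite: SGA1, Exp. XII Prop. 3.1 (xi)] [cite: GortzWedhorn2020, §(3.5) Example 3.11] -/
theorem isClopenPartition_range_map (hcol : IsColimit (Cofan.mk X inj)) :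
    IsClopenPartition (fun c => Set.range (AlgPoints.map (L := ℂ) (inj c) : ComplexPoints (Y c) → ComplexPoints X)) := by
  obtain ⟨hc⟩ := Morphisms.isColimit_cofan_left hcol
  haveI : ∀ c, IsOpenImmersion (inj c).left := fun c => Morphisms.isOpenImmersion_of_isColimit_cofan hc c
  refine ⟨fun c => (AlgPoints.isOpenEmbedding_map_holds (L := ℂ) (inj c)).isOpen_range, fun c d hcd => ?_, fun Q => ?_⟩
  · rw [AlgPoints.range_map_of_isOpenImmersion_holds (L := ℂ) (inj c),
      AlgPoints.range_map_of_isOpenImmersion_holds (L := ℂ) (inj d)]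
    have hdisj := Morphisms.pairwise_disjoint_range_of_isColimit_cofan hc hcd
    exact Set.disjoint_left.2 fun Q hQc hQd => Set.disjoint_left.1 hdisj hQc hQd
  · obtain ⟨c, y, hy⟩ := Morphisms.exists_eq_of_isColimit_cofan hc Q.pt
    refine ⟨c, ?_⟩
    rw [AlgPoints.range_map_of_isOpenImmersion_holds (L := ℂ) (inj c)]
    exact ⟨y, hy⟩

set_option maxHeartbeats 800000 in
/-- **Additivity of Betti cohomology over a colimit cofan of complex schemes**: `x ↦ ((inj_c)^* x)_c :
Hⁿ(X(ℂ); ℚ) → Π_c Hⁿ(Y_c(ℂ); ℚ)` is bijective (Hatcher 2002, §3.1 p. 202 `Hⁿ(∐_α X_α; G) ≅ ∏_α Hⁿ(X_α; G)`, in the tree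
`singularCohomology.piRestrict_bijective`, composed with the homeomorphisms `Y_c(ℂ) ≃ₜ im (inj_c)(ℂ)`).
[cite: HatcherAT2002, §3.1 p. 202] [cite: SGA1, Exp. XII Prop. 3.1 (xi)] -/
theorem bijective_pi_pull (hcol : IsColimit (Cofan.mk X inj)) (n : ℕ) :
    Bijective (fun x : bettiCohomology X n => fun c => HodgeTheory.BettiUniverse.pull (inj c) n x) := by
  have hA := isClopenPartition_range_map hcol
  obtain ⟨hc⟩ := Morphisms.isColimit_cofan_left hcol
  haveI : ∀ c, IsOpenImmersion (inj c).left := fun c => Morphisms.isOpenImmersion_of_isColimit_cofan hc c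
  -- the homeomorphisms `Y_c(ℂ) ≃ₜ im (inj_c)(ℂ)` and the factorisation `subsetIncl ∘ e_c = (inj_c)(ℂ)`
  let e : ∀ c, ComplexPoints (Y c) ≃ₜ ↥(Set.range (AlgPoints.map (L := ℂ) (inj c) : ComplexPoints (Y c) → ComplexPoints X)) :=
    fun c => (AlgPoints.isOpenEmbedding_map_holds (L := ℂ) (inj c)).isEmbedding.toHomeomorph
  have hfac : ∀ c, (subsetIncl (Set.range (AlgPoints.map (L := ℂ) (inj c) : ComplexPoints (Y c) → ComplexPoints X))).comp
      (e c : C(ComplexPoints (Y c), ↥(Set.range (AlgPoints.map (L := ℂ) (inj c) : ComplexPoints (Y c) → ComplexPoints X)))) =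
      AlgPoints.mapContinuous (L := ℂ) (inj c) := fun c => by
    ext P
    rfl
  -- the comparison `Π_c Hⁿ(im_c) ≃ Π_c Hⁿ(Y_c(ℂ))`
  let E : ∀ c, singularCohomology ℚ ℚ ↥(Set.range (AlgPoints.map (L := ℂ) (inj c) : ComplexPoints (Y c) → ComplexPoints X)) n ≃
      bettiCohomology (Y c) n :=
    fun c => (singularCohomology.mapIso ℚ ℚ (e c) n).toLinearEquiv.toEquiv
  have key : ∀ (x : bettiCohomology X n) (c : κ),
      HodgeTheory.BettiUniverse.pull (inj c) n x =
        E c (singularCohomology.piRestrict ℚ ℚ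
          (fun c => Set.range (AlgPoints.map (L := ℂ) (inj c) : ComplexPoints (Y c) → ComplexPoints X)) n x c) := by
    intro x c
    rw [singularCohomology.piRestrict_apply]
    change (bettiCohomology.map (inj c) n).hom x =
      (singularCohomology.mapIso ℚ ℚ (e c) n).hom ((singularCohomology.map ℚ ℚ (subsetIncl _) n).hom x)
    rw [singularCohomology.mapIso_hom, bettiCohomology.map, ← hfac c, singularCohomology.map_comp, ModuleCat.hom_comp,
      LinearMap.comp_apply]
  have hF : (fun x : bettiCohomology X n => fun c => HodgeTheory.BettiUniverse.pull (inj c) n x) =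
      (Equiv.piCongrRight E) ∘ singularCohomology.piRestrict ℚ ℚ
        (fun c => Set.range (AlgPoints.map (L := ℂ) (inj c) : ComplexPoints (Y c) → ComplexPoints X)) n := by
    funext x c
    rw [key x c]
    rfl
  rw [hF]
  exact (Equiv.piCongrRight E).bijective.comp (singularCohomology.piRestrict_bijective hA n)

/-- Uniqueness form: a Betti class restricting to `0` on every leg of a colimit cofan is `0`. [cite: HatcherAT2002, §3.1 p. 202] -/
theorem eq_zero_of_forall_pull_eq_zero (hcol : IsColimit (Cofan.mk X inj)) {n : ℕ} {x : bettiCohomology X n}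
    (h : ∀ c, HodgeTheory.BettiUniverse.pull (inj c) n x = 0) : x = 0 :=
  (bijective_pi_pull hcol n).1 ((funext h).trans (funext fun _ => (map_zero _).symm))

/-- Existence form: any family of classes on the legs of a colimit cofan is the restriction of one class.
[cite: HatcherAT2002, §3.1 p. 202] -/
theorem exists_forall_pull_eq (hcol : IsColimit (Cofan.mk X inj)) {n : ℕ} (y : ∀ c, bettiCohomology (Y c) n) :
    ∃ x : bettiCohomology X n, ∀ c, HodgeTheory.BettiUniverse.pull (inj c) n x = y c := by
  obtain ⟨x, hx⟩ := (bijective_pi_pull hcol n).2 y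
  exact ⟨x, fun c => congrFun hx c⟩

end Literature.AlgebraicGeometry.Motives.BettiCofan

end
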